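import Summits.AtomisticToContinuum.HydrodynamicLimit.Theses.InformationPercolationEngine
import Summits.AtomisticToContinuum.HydrodynamicLimit.Theorems.InformationPercolationEngineKineticClosureBridge
import Literature.Analysis.FluidPDE.HardSphereFreeStretch
import HarnessLib

/-!
# The exact pathwise continuity equation of the cone-mollified empirical density

Stub `stub_massBalance` of line `Sketch` of the crux `InformationPercolationEngine.ChaosClosesEuler`
(stmt-AtomisticToContinuum-15141): along ONE good orbit `s ↦ Φ.flow s z` of the hard-sphere flow on `𝕋³`, the
`r`-cone-mollified empirical density `ρ_r` and momentum `m_r` satisfy `∂ₛρ_r + div m_r = 0` exactly, in the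
weak-in-`x`, integrated-in-time form tested against a smooth space-time `φ`:
`∫φ(t)ρ_r(t) − ∫φ(0)ρ_r(0) = ∫₀ᵗ ∫ (∂ₛφ ρ_r + m_r·∇φ)`. This is a DETERMINISTIC identity (Bogolyubov's exact weak
equation for the empirical measure of one trajectory, mass component; Pulvirenti–Simonella, arXiv:1504.03215 §1,
(1.3)–(1.5): between collisions the empirical measure is transported freely, and collisions move no mass).

PROOF. The cone `b_r(y, x) = 3/(πr³)(1 − d(y,x)/r)₊` depends on the torus difference only, `b_r(y,x) = h(x − y)`, so
NO derivative ever falls on the Lipschitz cone: by translation invariance of the Haar measure,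
`∫ φ(s,x) h(x − y(s)) dx = ∫ φ(s, u + y(s)) h(u) du` (`integral_mul_comp_sub`), and along a free flight
`y(s) = y₀ + proj((s−a)v)` the `s`-dependence sits in the smooth factor; the chain rule through the space-time lift
(`fderiv_stLift_one`, `hasDerivAt_comp_freeFlight`) and dominated differentiation on the compact torus
(`hasDerivAt_integral_freeFlight`) give the transport derivative `∫ (∂ₛφ + ∑ₖ vₖ∂ₖφ) h(x − y(s)) dx`, continuous in `s`.
On an inter-collision interval positions follow the free flight with endpoints included (positions are continuous,
`pos_eq_of_free`) and velocities are frozen off the right endpoint (`vel_eq_of_free`), so the fundamental theorem of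
calculus gives the balance on each free stretch (`ftc_free`); induction on the finite number of collision times in
`(a, b)` glues the stretches (`ftc_pieces`); `stub_massBalance` unfolds the empirical integrals
(`integral_empiricalMeasure`) and rearranges the finite sums.

NOT here: the momentum / energy balances (their collisional transfer does not vanish), any probability.
-/

noncomputable section

namespace Summit.AtomisticToContinuum.HydrodynamicLimit.Theorems.ChaosClosesEulerMassBalance

open scoped BigOperators Topology Classical MeasureTheory ENNReal InnerProductSpace
open Filter Set MeasureTheory
open Literature.MathematicalPhysics.KineticTheory
open Literature.Analysis.FluidPDE

section Calculus

open Literature.Analysis.FunctionSpaces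

/-- Translation invariance of the Haar probability measure of `𝕋³`: a kernel depending on the torus difference
`x - y` can be recentred, `∫ f(x) h(x − y) dx = ∫ f(u + y) h(u) du`. [folklore] -/
theorem integral_mul_comp_sub (f h : T3 → ℝ) (y : T3) : ∫ x, f x * h (x - y) = ∫ u, f (u + y) * h u := by
  have key := integral_add_right_eq_self (μ := (volume : Measure T3)) (fun x => f x * h (x - y)) y
  simp only [add_sub_cancel_right] at key
  exact key.symm

/-- A jointly smooth space-time field on all of `ℝ` has a `C^∞` space-time lift. [folklore] -/
theorem contDiff_stLift {φ : ℝ → T3 → ℝ} (hφ : Torus.IsSmoothSpaceTimeOn Set.univ φ) :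
    ContDiff ℝ ((⊤ : ℕ∞) : WithTop ℕ∞) (Torus.stLift φ) := by
  have h : ContDiffOn ℝ ((⊤ : ℕ∞) : WithTop ℕ∞) (Torus.stLift φ) (Set.univ ×ˢ Set.univ) := hφ
  rwa [Set.univ_prod_univ, contDiffOn_univ] at h

/-- The time derivative of a smooth space-time field is the derivative of its lift in the direction `(1, 0)`.
[folklore] -/
theorem hasDerivAt_time_stLift {φ : ℝ → T3 → ℝ} (hφ : Torus.IsSmoothSpaceTimeOn Set.univ φ) (s : ℝ) (ξ : V3) :
    HasDerivAt (fun s' => φ s' (Torus.proj ξ)) (fderiv ℝ (Torus.stLift φ) (s, ξ) ((1 : ℝ), (0 : V3))) s :=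
  ((contDiff_stLift hφ).differentiable (by simp)).differentiableAt.hasFDerivAt.comp_hasDerivAt s
    ((hasDerivAt_id s).prodMk (hasDerivAt_const s ξ))

/-- The space derivative of a time slice is the derivative of the lift in the direction `(0, w)`. [folklore] -/
theorem torusFderiv_slice_eq {φ : ℝ → T3 → ℝ} (hφ : Torus.IsSmoothSpaceTimeOn Set.univ φ) (s : ℝ) (ξ w : V3) :
    Torus.fderiv (φ s) (Torus.proj ξ) w = fderiv ℝ (Torus.stLift φ) (s, ξ) ((0 : ℝ), w) := by
  have hcomp : HasFDerivAt (Torus.lift (φ s)) ((fderiv ℝ (Torus.stLift φ) (s, ξ)).comp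
      (ContinuousLinearMap.inr ℝ ℝ V3)) ξ :=
    ((contDiff_stLift hφ).differentiable (by simp)).differentiableAt.hasFDerivAt.comp ξ
      (hasFDerivAt_prodMk_right s ξ)
  rw [← Torus.fderiv_lift, hcomp.fderiv]
  rfl

/-- **Chain rule along a line.** For a smooth space-time field `φ` and a velocity `v`, the derivative of the lift in
the direction `(1, v)` is `∂ₛφ + ∑ₖ vₖ ∂ₖφ` read on the torus. [folklore] -/
theorem fderiv_stLift_one {φ : ℝ → T3 → ℝ} (hφ : Torus.IsSmoothSpaceTimeOn Set.univ φ) (v : V3) (s : ℝ) (ξ : V3) :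
    fderiv ℝ (Torus.stLift φ) (s, ξ) ((1 : ℝ), v) =
      deriv (fun s' => φ s' (Torus.proj ξ)) s + ∑ k : Fin 3, v k * Torus.partialDeriv k (φ s) (Torus.proj ξ) := by
  have h1 : ((1 : ℝ), v) = ((1 : ℝ), (0 : V3)) + ((0 : ℝ), v) := by simp
  rw [h1, map_add, (hasDerivAt_time_stLift hφ s ξ).deriv]
  congr 1
  have hs1 : Torus.IsContDiff 1 (φ s) := (hφ.isSmooth_slice (Set.mem_univ s)).isContDiff (by simp)
  have hv : v = ∑ k : Fin 3, v k • EuclideanSpace.single k (1 : ℝ) := by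
    conv_lhs => rw [← (EuclideanSpace.basisFun (Fin 3) ℝ).sum_repr v]
    simp
  rw [← torusFderiv_slice_eq hφ s ξ v]
  conv_lhs => rw [hv]
  rw [map_sum]
  refine Finset.sum_congr rfl fun k _ => ?_
  rw [map_smul, smul_eq_mul, Torus.partialDeriv_eq_fderiv_apply hs1]

/-- The transport derivative `(s, x) ↦ ∂ₛφ(s, x) + ∑ₖ vₖ ∂ₖφ(s, ·)(x)` of a smooth space-time field is jointly
continuous (it lifts to `Dφ̃(s, ξ)(1, v)` through the open quotient map `id × proj`). [folklore] -/
theorem continuous_transportDeriv {φ : ℝ → T3 → ℝ} (hφ : Torus.IsSmoothSpaceTimeOn Set.univ φ) (v : V3) :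
    Continuous fun p : ℝ × T3 =>
      deriv (fun s' => φ s' p.2) p.1 + ∑ k : Fin 3, v k * Torus.partialDeriv k (φ p.1) p.2 := by
  have hq : IsOpenQuotientMap (Prod.map (id : ℝ → ℝ) (Torus.proj : V3 → T3)) :=
    IsOpenQuotientMap.id.prodMap Torus.isOpenQuotientMap_proj
  rw [← hq.continuous_comp_iff]
  have heq : ((fun p : ℝ × T3 =>
      deriv (fun s' => φ s' p.2) p.1 + ∑ k : Fin 3, v k * Torus.partialDeriv k (φ p.1) p.2) ∘
        Prod.map (id : ℝ → ℝ) (Torus.proj : V3 → T3)) =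
      fun q : ℝ × V3 => fderiv ℝ (Torus.stLift φ) q ((1 : ℝ), v) := by
    funext q
    simp only [Function.comp_apply, Prod.map_fst, Prod.map_snd, id_eq]
    exact (fderiv_stLift_one hφ v q.1 q.2).symm
  rw [heq]
  exact ((contDiff_stLift hφ).continuous_fderiv (by simp)).clm_apply continuous_const

/-- **Chain rule along a free flight.** `s ↦ φ(s, x₀ + proj((s − a)v))` has derivative `∂ₛφ + ∑ₖ vₖ ∂ₖφ` at the
moving point. [folklore] -/
theorem hasDerivAt_comp_freeFlight {φ : ℝ → T3 → ℝ} (hφ : Torus.IsSmoothSpaceTimeOn Set.univ φ) (x₀ : T3)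
    (v : V3) (a s : ℝ) :
    HasDerivAt (fun s' => φ s' (x₀ + Torus.proj ((s' - a) • v)))
      (deriv (fun s' => φ s' (x₀ + Torus.proj ((s - a) • v))) s
        + ∑ k : Fin 3, v k * Torus.partialDeriv k (φ s) (x₀ + Torus.proj ((s - a) • v))) s := by
  obtain ⟨ξ₀, hξ₀⟩ := Torus.proj_surjective x₀
  have hpt : ∀ s' : ℝ, x₀ + Torus.proj ((s' - a) • v) = Torus.proj (ξ₀ + (s' - a) • v) := by
    intro s'
    rw [Torus.proj_add, hξ₀]
  have hfun : (fun s' => φ s' (x₀ + Torus.proj ((s' - a) • v))) =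
      Torus.stLift φ ∘ fun s' => (s', ξ₀ + (s' - a) • v) := by
    funext s'
    simp only [Function.comp_apply, Torus.stLift_apply, hpt]
  have hι : HasDerivAt (fun s' : ℝ => (s', ξ₀ + (s' - a) • v)) ((1 : ℝ), v) s := by
    refine (hasDerivAt_id s).prodMk ?_
    simpa using (((hasDerivAt_id s).sub_const a).smul_const v).const_add ξ₀
  rw [hfun]
  refine (((contDiff_stLift hφ).differentiable (by simp)).differentiableAt.hasFDerivAt.comp_hasDerivAt s
    hι).congr_deriv ?_
  rw [fderiv_stLift_one hφ v s, ← hpt]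

/-- The transport derivative integrated against a recentred continuous kernel is continuous in time. [folklore] -/
theorem continuous_integral_transportDeriv {φ : ℝ → T3 → ℝ} (hφ : Torus.IsSmoothSpaceTimeOn Set.univ φ)
    {h : T3 → ℝ} (hh : Continuous h) (y₀ : T3) (v : V3) (a : ℝ) :
    Continuous fun s => ∫ x, (deriv (fun s' => φ s' x) s + ∑ k : Fin 3, v k * Torus.partialDeriv k (φ s) x)
        * h (x - (y₀ + Torus.proj ((s - a) • v))) := by
  have hy : Continuous fun s : ℝ => y₀ + Torus.proj ((s - a) • v) :=
    continuous_const.add (Torus.continuous_proj.comp ((continuous_id.sub continuous_const).smul continuous_const))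
  have hint : Continuous (Function.uncurry fun (s : ℝ) (x : T3) =>
      (deriv (fun s' => φ s' x) s + ∑ k : Fin 3, v k * Torus.partialDeriv k (φ s) x)
        * h (x - (y₀ + Torus.proj ((s - a) • v)))) := by
    show Continuous fun p : ℝ × T3 =>
      (deriv (fun s' => φ s' p.2) p.1 + ∑ k : Fin 3, v k * Torus.partialDeriv k (φ p.1) p.2)
        * h (p.2 - (y₀ + Torus.proj ((p.1 - a) • v)))
    exact (continuous_transportDeriv hφ v).mul (hh.comp (continuous_snd.sub (hy.comp continuous_fst)))
  simpa only [Measure.restrict_univ] using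
    continuous_parametric_integral_of_continuous (μ := (volume : Measure T3)) hint isCompact_univ

/-- **Differentiation under the integral sign along a free flight.** For a smooth space-time `φ`, a continuous
kernel `h` and the free flight `y(s) = y₀ + proj((s − a)v)`, the pairing `s ↦ ∫ φ(s, x) h(x − y(s)) dx` is
differentiable with derivative `∫ (∂ₛφ + ∑ₖ vₖ∂ₖφ)(s, x) h(x − y(s)) dx` (recentre by translation invariance, then
dominated differentiation on the compact torus). [folklore] -/
theorem hasDerivAt_integral_freeFlight {φ : ℝ → T3 → ℝ} (hφ : Torus.IsSmoothSpaceTimeOn Set.univ φ)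
    {h : T3 → ℝ} (hh : Continuous h) (y₀ : T3) (v : V3) (a s : ℝ) :
    HasDerivAt (fun s' => ∫ x, φ s' x * h (x - (y₀ + Torus.proj ((s' - a) • v))))
      (∫ x, (deriv (fun s' => φ s' x) s + ∑ k : Fin 3, v k * Torus.partialDeriv k (φ s) x)
        * h (x - (y₀ + Torus.proj ((s - a) • v)))) s := by
  have hrew : (fun s' => ∫ x, φ s' x * h (x - (y₀ + Torus.proj ((s' - a) • v)))) =
      fun s' => ∫ u, φ s' (u + y₀ + Torus.proj ((s' - a) • v)) * h u := by
    funext s'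
    rw [integral_mul_comp_sub (φ s') h]
    simp only [add_assoc]
  have hrew' : (∫ x, (deriv (fun s' => φ s' x) s + ∑ k : Fin 3, v k * Torus.partialDeriv k (φ s) x)
        * h (x - (y₀ + Torus.proj ((s - a) • v)))) =
      ∫ u, (deriv (fun s' => φ s' (u + y₀ + Torus.proj ((s - a) • v))) s
        + ∑ k : Fin 3, v k * Torus.partialDeriv k (φ s) (u + y₀ + Torus.proj ((s - a) • v))) * h u := by
    rw [integral_mul_comp_sub
      (fun x => deriv (fun s' => φ s' x) s + ∑ k : Fin 3, v k * Torus.partialDeriv k (φ s) x) h]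
    simp only [add_assoc]
  rw [hrew, hrew']
  have hD := continuous_transportDeriv hφ v
  have hφc : ∀ s' : ℝ, Continuous (φ s') := fun s' => (hφ.isSmooth_slice (Set.mem_univ s')).continuous
  have hmove : ∀ s' : ℝ, Continuous fun u : T3 => u + y₀ + Torus.proj ((s' - a) • v) := fun s' =>
    (continuous_id.add continuous_const).add continuous_const
  -- a uniform bound of the transport derivative on `closedBall s 1 × 𝕋³`
  obtain ⟨M, hM⟩ := ((isCompact_closedBall s 1).prod (isCompact_univ (X := T3))).exists_bound_of_continuousOn
    hD.continuousOn
  refine (hasDerivAt_integral_of_dominated_loc_of_deriv_le (μ := (volume : Measure T3))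
    (F := fun (s' : ℝ) (u : T3) => φ s' (u + y₀ + Torus.proj ((s' - a) • v)) * h u)
    (F' := fun (s' : ℝ) (u : T3) => (deriv (fun s'' => φ s'' (u + y₀ + Torus.proj ((s' - a) • v))) s'
        + ∑ k : Fin 3, v k * Torus.partialDeriv k (φ s') (u + y₀ + Torus.proj ((s' - a) • v))) * h u)
    (x₀ := s) (bound := fun u => M * ‖h u‖) (Metric.closedBall_mem_nhds s one_pos) ?_ ?_ ?_ ?_ ?_ ?_).2
  · exact Filter.Eventually.of_forall fun s' => (((hφc s').comp (hmove s')).mul hh).aestronglyMeasurable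
  · exact integrable_of_continuous_T3 (((hφc s).comp (hmove s)).mul hh)
  · exact ((hD.comp (continuous_const.prodMk (hmove s))).mul hh).aestronglyMeasurable
  · refine ae_of_all _ fun u s' hs' => ?_
    rw [norm_mul]
    exact mul_le_mul_of_nonneg_right (hM (s', u + y₀ + Torus.proj ((s' - a) • v)) ⟨hs', Set.mem_univ _⟩)
      (norm_nonneg _)
  · exact (integrable_of_continuous_T3 hh).norm.const_mul M
  · exact ae_of_all _ fun u s' _ => (hasDerivAt_comp_freeFlight hφ (u + y₀) v a s').mul_const (h u)

end Calculus

section Trajectory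

open Literature.Analysis.FunctionSpaces

variable {n : ℕ} {ε : ℝ} {γ : ℝ → Config n (Fin 3) T3}

/-- On a collision-free open time interval the velocities of a hard-sphere trajectory are frozen (free flight on
`(a, s] ⊆ (a, b)`). [folklore] -/
theorem vel_eq_of_free (hγ : IsHardSphereTrajectory (Torus.geometry (Fin 3)) ε n γ) {a b s : ℝ}
    (hfree : ∀ τ ∈ Set.Ioo a b, τ ∉ collisionTimes (Torus.geometry (Fin 3)) ε γ) (hs : s ∈ Set.Ico a b)
    (i : Fin n) : (γ s i).2 = (γ a i).2 := by
  rw [hγ.free a s hs.1 fun τ hτ => hfree τ ⟨hτ.1, lt_of_le_of_lt hτ.2 hs.2⟩, freeFlight_apply]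

/-- On a collision-free open time interval the positions of a hard-sphere trajectory follow the free flight,
endpoints included (positions are continuous). [folklore] -/
theorem pos_eq_of_free (hγ : IsHardSphereTrajectory (Torus.geometry (Fin 3)) ε n γ) {a b s : ℝ}
    (hfree : ∀ τ ∈ Set.Ioo a b, τ ∉ collisionTimes (Torus.geometry (Fin 3)) ε γ) (hs : s ∈ Set.Icc a b)
    (i : Fin n) : (γ s i).1 = (γ a i).1 + Torus.proj ((s - a) • (γ a i).2) := by
  rcases eq_or_lt_of_le hs.1 with h | h
  · subst h
    simp
  · rw [hγ.apply_fst_eq_freeFlight_of_Ioo_free Torus.continuous_geometry_translate h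
      (fun τ hτ => hfree τ ⟨hτ.1, lt_of_lt_of_le hτ.2 hs.2⟩) i, freeFlight_apply, Torus.geometry_translate]

/-- **Mass balance on a free stretch.** On a time interval `[a, b]` without collision in `(a, b)`, the pairing of a
smooth space-time `φ` with the superposition of recentred kernels `∑ᵢ h(· − xᵢ(s))` is differentiable with the
transport derivative, which is continuous; the fundamental theorem of calculus gives the integrated balance, and
the trajectory integrand (which reads the actual velocities) agrees with it off the endpoints. [folklore] -/
theorem ftc_free (hγ : IsHardSphereTrajectory (Torus.geometry (Fin 3)) ε n γ)
    {φ : ℝ → T3 → ℝ} (hφ : Torus.IsSmoothSpaceTimeOn Set.univ φ) {h : T3 → ℝ} (hh : Continuous h)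
    {a b : ℝ} (hab : a ≤ b) (hfree : ∀ τ ∈ Set.Ioo a b, τ ∉ collisionTimes (Torus.geometry (Fin 3)) ε γ) :
    IntervalIntegrable (fun s => ∫ x, ∑ i, (deriv (fun s' => φ s' x) s
        + ∑ k : Fin 3, (γ s i).2 k * Torus.partialDeriv k (φ s) x) * h (x - (γ s i).1)) volume a b ∧
    ∫ s in a..b, (∫ x, ∑ i, (deriv (fun s' => φ s' x) s
        + ∑ k : Fin 3, (γ s i).2 k * Torus.partialDeriv k (φ s) x) * h (x - (γ s i).1)) =
      (∫ x, φ b x * ∑ i, h (x - (γ b i).1)) - ∫ x, φ a x * ∑ i, h (x - (γ a i).1) := by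
  have hφc : ∀ s' : ℝ, Continuous (φ s') := fun s' => (hφ.isSmooth_slice (Set.mem_univ s')).continuous
  have hpos : ∀ s ∈ Set.Icc a b, ∀ i, (γ s i).1 = (γ a i).1 + Torus.proj ((s - a) • (γ a i).2) :=
    fun s hs i => pos_eq_of_free hγ hfree hs i
  have hvel : ∀ s ∈ Set.Ico a b, ∀ i, (γ s i).2 = (γ a i).2 := fun s hs i => vel_eq_of_free hγ hfree hs i
  -- the sum over particles of the free-flight pairings, its derivative, FTC
  have hsum : ∀ s, HasDerivAt
      (fun s' => ∑ i, ∫ x, φ s' x * h (x - ((γ a i).1 + Torus.proj ((s' - a) • (γ a i).2))))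
      (∑ i, ∫ x, (deriv (fun s' => φ s' x) s + ∑ k : Fin 3, (γ a i).2 k * Torus.partialDeriv k (φ s) x)
        * h (x - ((γ a i).1 + Torus.proj ((s - a) • (γ a i).2)))) s :=
    fun s => HasDerivAt.fun_sum fun i _ => hasDerivAt_integral_freeFlight hφ hh (γ a i).1 (γ a i).2 a s
  have hsumc : Continuous fun s => ∑ i, ∫ x, (deriv (fun s' => φ s' x) s
      + ∑ k : Fin 3, (γ a i).2 k * Torus.partialDeriv k (φ s) x)
        * h (x - ((γ a i).1 + Torus.proj ((s - a) • (γ a i).2))) :=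
    continuous_finsetSum _ fun i _ => continuous_integral_transportDeriv hφ hh (γ a i).1 (γ a i).2 a
  have hftc := intervalIntegral.integral_eq_sub_of_hasDerivAt (fun s _ => hsum s) (hsumc.intervalIntegrable a b)
  -- identification with the trajectory functionals
  have hF : ∀ s ∈ Set.Icc a b, (∫ x, φ s x * ∑ i, h (x - (γ s i).1)) =
      ∑ i, ∫ x, φ s x * h (x - ((γ a i).1 + Torus.proj ((s - a) • (γ a i).2))) := by
    intro s hs
    rw [← integral_finsetSum]
    · refine integral_congr_ae (ae_of_all _ fun x => ?_)
      show φ s x * ∑ i, h (x - (γ s i).1) = ∑ i, φ s x * h (x - ((γ a i).1 + Torus.proj ((s - a) • (γ a i).2)))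
      rw [Finset.mul_sum]
      exact Finset.sum_congr rfl fun i _ => by rw [hpos s hs i]
    · exact fun i _ => integrable_of_continuous_T3 ((hφc s).mul (hh.comp (continuous_id.sub continuous_const)))
  have hR : Set.EqOn (fun s => ∫ x, ∑ i, (deriv (fun s' => φ s' x) s
        + ∑ k : Fin 3, (γ s i).2 k * Torus.partialDeriv k (φ s) x) * h (x - (γ s i).1))
      (fun s => ∑ i, ∫ x, (deriv (fun s' => φ s' x) s
        + ∑ k : Fin 3, (γ a i).2 k * Torus.partialDeriv k (φ s) x)
          * h (x - ((γ a i).1 + Torus.proj ((s - a) • (γ a i).2)))) (Set.uIoo a b) := by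
    intro s hs
    rw [Set.uIoo_of_le hab] at hs
    show (∫ x, ∑ i, (deriv (fun s' => φ s' x) s
        + ∑ k : Fin 3, (γ s i).2 k * Torus.partialDeriv k (φ s) x) * h (x - (γ s i).1)) =
      ∑ i, ∫ x, (deriv (fun s' => φ s' x) s
        + ∑ k : Fin 3, (γ a i).2 k * Torus.partialDeriv k (φ s) x)
          * h (x - ((γ a i).1 + Torus.proj ((s - a) • (γ a i).2)))
    rw [← integral_finsetSum]
    · refine integral_congr_ae (ae_of_all _ fun x => Finset.sum_congr rfl fun i _ => ?_)
      rw [hpos s ⟨hs.1.le, hs.2.le⟩ i, hvel s ⟨hs.1.le, hs.2⟩ i]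
    · exact fun i _ => integrable_of_continuous_T3 (((continuous_transportDeriv hφ _).comp
        (continuous_const.prodMk continuous_id)).mul (hh.comp (continuous_id.sub continuous_const)))
  refine ⟨(hsumc.intervalIntegrable a b).congr_uIoo hR.symm, ?_⟩
  rw [intervalIntegral.integral_congr_uIoo hR, hftc, hF b ⟨hab, le_rfl⟩, hF a ⟨le_rfl, hab⟩]

/-- **Mass balance along a hard-sphere trajectory, piece by piece.** Induction on the number of collision times in
`(a, b)`: the free-stretch identity `ftc_free` on each inter-collision interval, glued additively (collisions move no
mass: positions are continuous, only velocities jump). [folklore] -/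
theorem ftc_pieces (hγ : IsHardSphereTrajectory (Torus.geometry (Fin 3)) ε n γ)
    {φ : ℝ → T3 → ℝ} (hφ : Torus.IsSmoothSpaceTimeOn Set.univ φ) {h : T3 → ℝ} (hh : Continuous h) :
    ∀ (m : ℕ) {a b : ℝ}, a ≤ b → (collisionTimes (Torus.geometry (Fin 3)) ε γ ∩ Set.Ioo a b).ncard ≤ m →
    IntervalIntegrable (fun s => ∫ x, ∑ i, (deriv (fun s' => φ s' x) s
        + ∑ k : Fin 3, (γ s i).2 k * Torus.partialDeriv k (φ s) x) * h (x - (γ s i).1)) volume a b ∧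
    ∫ s in a..b, (∫ x, ∑ i, (deriv (fun s' => φ s' x) s
        + ∑ k : Fin 3, (γ s i).2 k * Torus.partialDeriv k (φ s) x) * h (x - (γ s i).1)) =
      (∫ x, φ b x * ∑ i, h (x - (γ b i).1)) - ∫ x, φ a x * ∑ i, h (x - (γ a i).1) := by
  have hfin : ∀ a b : ℝ, (collisionTimes (Torus.geometry (Fin 3)) ε γ ∩ Set.Ioo a b).Finite := fun a b =>
    (hγ.locFinite a b).subset (Set.inter_subset_inter_right _ Set.Ioo_subset_Icc_self)
  intro m
  induction m with
  | zero =>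
    intro a b hab hcard
    have hempty : collisionTimes (Torus.geometry (Fin 3)) ε γ ∩ Set.Ioo a b = ∅ :=
      (Set.ncard_eq_zero (hfin a b)).1 (Nat.le_zero.1 hcard)
    refine ftc_free hγ hφ hh hab fun τ hτ hτC => ?_
    have hmem : τ ∈ collisionTimes (Torus.geometry (Fin 3)) ε γ ∩ Set.Ioo a b := ⟨hτC, hτ⟩
    rw [hempty] at hmem
    exact hmem
  | succ m ih =>
    intro a b hab hcard
    by_cases hex : ∃ τ ∈ Set.Ioo a b, τ ∈ collisionTimes (Torus.geometry (Fin 3)) ε γ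
    · obtain ⟨τ, hτ, hτC⟩ := hex
      have hcut : ∀ I : Set ℝ, τ ∉ I → collisionTimes (Torus.geometry (Fin 3)) ε γ ∩ I ⊆
          collisionTimes (Torus.geometry (Fin 3)) ε γ ∩ Set.Ioo a b →
          (collisionTimes (Torus.geometry (Fin 3)) ε γ ∩ I).ncard ≤ m := by
        intro I hτI hsub
        have hss : collisionTimes (Torus.geometry (Fin 3)) ε γ ∩ I ⊂
            collisionTimes (Torus.geometry (Fin 3)) ε γ ∩ Set.Ioo a b :=
          Set.ssubset_iff_subset_ne.2 ⟨hsub, fun heq => by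
            have hmem : τ ∈ collisionTimes (Torus.geometry (Fin 3)) ε γ ∩ I := by rw [heq]; exact ⟨hτC, hτ⟩
            exact hτI hmem.2⟩
        have := Set.ncard_lt_ncard hss (hfin a b)
        omega
      obtain ⟨hi1, he1⟩ := ih hτ.1.le (hcut (Set.Ioo a τ) (fun h' => lt_irrefl τ h'.2)
        (Set.inter_subset_inter_right _ (Set.Ioo_subset_Ioo_right hτ.2.le)))
      obtain ⟨hi2, he2⟩ := ih hτ.2.le (hcut (Set.Ioo τ b) (fun h' => lt_irrefl τ h'.1)
        (Set.inter_subset_inter_right _ (Set.Ioo_subset_Ioo_left hτ.1.le)))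
      refine ⟨hi1.trans hi2, ?_⟩
      rw [← intervalIntegral.integral_add_adjacent_intervals hi1 hi2, he1, he2]
      ring
    · push Not at hex
      exact ftc_free hγ hφ hh hab fun τ hτ => hex τ hτ

end Trajectory

/-- Integration of a velocity-weighted vector function against the empirical measure: `∫ g(q) q.2 dμ_w =
n⁻¹ ∑ᵢ g(wᵢ) vᵢ` (vector companion of the tree's `integral_empiricalMeasure`). [folklore] -/
theorem integral_empiricalMeasure_smul {n : ℕ} (w : Config n (Fin 3) T3) (g : T3 × V3 → ℝ) :
    ∫ q, g q • q.2 ∂(empiricalMeasure w) = (n : ℝ)⁻¹ • ∑ i, g (w i) • (w i).2 := by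
  rw [empiricalMeasure, integral_smul_measure, integral_finsetSum_measure]
  · simp [integral_dirac, ENNReal.toReal_inv]
  · exact fun i _ => integrable_dirac (by simp)

/-- **The exact pathwise continuity equation of the cone-mollified empirical density** (stub `stub_massBalance` of
line `Sketch`, crux `ChaosClosesEuler`, stmt-AtomisticToContinuum-15141). Along one good orbit `s ↦ Φ.flow s z` of the
hard-sphere flow, for the `r`-cone-mollified density `ρ_r(w)(x₀) = ∫ b_r(q.1, x₀) dμ_w` and momentum
`m_r(w)(x₀) = ∫ b_r(q.1, x₀) q.2 dμ_w` and every smooth space-time test function `φ`,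
`∫ φ(t)ρ_r(t) − ∫ φ(0)ρ_r(0) = ∫_{[0,t]} ∫ (∂ₛφ ρ_r(s) + ∑ₖ (m_r(s))ₖ ∂ₖφ(s))` — a deterministic identity
(Bogolyubov's exact weak equation for the empirical measure of one trajectory, mass component; Pulvirenti–Simonella
arXiv:1504.03215 §1 (1.3)–(1.5)): free transport between collisions, and collisions move no mass. -/
theorem stub_massBalance :
    ∀ (σ : ℝ), 0 < σ → σ < 2⁻¹ → ∀ (N : ℕ)
    (Φ : HardSphereFlow (Torus.geometry (Fin 3)) (hsDiameter σ N) (N + 1)),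
    ∀ z ∈ Φ.good, ∀ r : ℝ, 0 < r → r < 2⁻¹ →
    ∀ φ : ℝ → T3 → ℝ, Literature.Analysis.FunctionSpaces.Torus.IsSmoothSpaceTimeOn Set.univ φ →
    ∀ t : ℝ, 0 ≤ t →
    let bx : T3 → T3 → ℝ := fun y x => 3 / (Real.pi * r ^ 3) * max (1 - Torus.euclidDist y x / r) 0
    let ρm : Config (N + 1) (Fin 3) T3 → T3 → ℝ := fun w x₀ => ∫ q, bx q.1 x₀ ∂(empiricalMeasure w)
    let mm : Config (N + 1) (Fin 3) T3 → T3 → V3 := fun w x₀ => ∫ q, bx q.1 x₀ • q.2 ∂(empiricalMeasure w)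
    (∫ x, φ t x * ρm (Φ.flow t z) x) - ∫ x, φ 0 x * ρm (Φ.flow 0 z) x =
      ∫ s in Set.Icc 0 t, ∫ x, (deriv (fun s' => φ s' x) s * ρm (Φ.flow s z) x
        + ∑ k : Fin 3, mm (Φ.flow s z) x k * Literature.Analysis.FunctionSpaces.Torus.partialDeriv k (φ s) x) := by
  intro σ hσ hσ2 N Φ z hz r hr hr2 φ hφ t ht
  dsimp only
  have hγ : IsHardSphereTrajectory (Torus.geometry (Fin 3)) (hsDiameter σ N) (N + 1) (fun s => Φ.flow s z) :=
    Φ.isTrajectory z hz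
  -- the cone kernel depends on the torus difference only
  set hc : T3 → ℝ := fun w => 3 / (Real.pi * r ^ 3) * max (1 - ‖Torus.reprSym w‖ / r) 0 with hhc
  have hcont : Continuous hc :=
    continuous_const.mul ((continuous_const.sub (Torus.continuous_norm_reprSym.div_const r)).max continuous_const)
  have hbx : ∀ y x : T3, 3 / (Real.pi * r ^ 3) * max (1 - Torus.euclidDist y x / r) 0 = hc (x - y) := by
    intro y x
    rw [hhc, Torus.euclidDist_comm, Torus.euclidDist_eq]
  simp_rw [hbx, integral_empiricalMeasure, integral_empiricalMeasure_smul]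
  -- rearrangement of the finite sums
  have hL : ∀ s, (∫ x, φ s x * (((N + 1 : ℕ) : ℝ)⁻¹ * ∑ i, hc (x - (Φ.flow s z i).1))) =
      ((N + 1 : ℕ) : ℝ)⁻¹ * ∫ x, φ s x * ∑ i, hc (x - (Φ.flow s z i).1) := by
    intro s
    rw [← integral_const_mul]
    exact integral_congr_ae (ae_of_all _ fun x => by ring)
  have hR : ∀ (s : ℝ) (x : T3), deriv (fun s' => φ s' x) s * (((N + 1 : ℕ) : ℝ)⁻¹ * ∑ i, hc (x - (Φ.flow s z i).1))
      + ∑ k : Fin 3, ((((N + 1 : ℕ) : ℝ)⁻¹ • ∑ i, hc (x - (Φ.flow s z i).1) • (Φ.flow s z i).2 : V3)) k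
          * Literature.Analysis.FunctionSpaces.Torus.partialDeriv k (φ s) x =
      ((N + 1 : ℕ) : ℝ)⁻¹ * ∑ i, (deriv (fun s' => φ s' x) s
        + ∑ k : Fin 3, (Φ.flow s z i).2 k * Literature.Analysis.FunctionSpaces.Torus.partialDeriv k (φ s) x)
          * hc (x - (Φ.flow s z i).1) := by
    intro s x
    simp only [WithLp.ofLp_smul, WithLp.ofLp_sum, Finset.sum_apply, Pi.smul_apply, smul_eq_mul]
    simp only [Finset.mul_sum, Finset.sum_mul, add_mul, mul_add, Finset.sum_add_distrib]
    congr 1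
    · exact Finset.sum_congr rfl fun i _ => by ring
    · rw [Finset.sum_comm]
      exact Finset.sum_congr rfl fun i _ => Finset.sum_congr rfl fun k _ => by ring
  rw [hL t, hL 0]
  simp_rw [hR, integral_const_mul]
  rw [← mul_sub, integral_Icc_eq_integral_Ioc, ← intervalIntegral.integral_of_le ht]
  congr 1
  exact ((ftc_pieces hγ hφ hcont _ ht le_rfl).2).symm

end Summit.AtomisticToContinuum.HydrodynamicLimit.Theorems.ChaosClosesEulerMassBalance
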